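import Literature.AnabelianGeometry.SemiGraphs.Example28CoverticialUniversal
import Literature.AnabelianGeometry.SemiGraphs.Example28CoverticialUniversalNecessity
import Literature.AnabelianGeometry.SemiGraphs.Example28CoverticialRepaired
import HarnessLib

/-!
# [SemiAnbd] Example 2.8, coverticial half — the repaired named fact HOLDS (F-1474 repaired)

Mochizuki, *Semi-graphs of anabelioids*, Publ. RIMS **42** (2006) 221–322, §2, Example 2.8, author's
manuscript p. 31 [cite: MochizukiSemiAnbd2006, Ex. 2.8 p.31]: if `𝒢_e` is trivial for all edges `e`,
"a closed edge abutting to vertices `v`, `w` is sub-coverticial (respectively, universally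
sub-coverticial) if and only if both `Π_v` and `Π_w` are nontrivial (respectively, infinite)."

PROOF-ONLY assembly (abc-iut cell, layer L3, row W4-31; FACT-LIST F-1474 and its repair).  The tree's
first rendering `example_2_8_coverticial` (`Coverticial.lean` rev 4) is refuted as typed at a loop
(`not_example_2_8_coverticial`); abc-iut-L3-t1's REPAIRED named fact `example_2_8_coverticial'`
(`Example28CoverticialRepaired.lean`: connected `𝒢`, trivial edge anabelioids; the sub-coverticial
criterion for `v ≠ w`, loops always sub-coverticial, the universally-sub-coverticial criterion as
printed) is here DISCHARGED:

* `SemiGraphOfAnabelioids.isUniversallySubCoverticial_iff` — the second conjunct verbatim AS TYPED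
  (`infinite_and_infinite_of_isUniversallySubCoverticial` + `isUniversallySubCoverticial_of_infinite`);
* `SemiGraphOfAnabelioids.example_2_8_coverticial_of_ne` — the whole printed statement for `v ≠ w`;
* `SemiGraphOfAnabelioids.example_2_8_coverticial'_holds` — t1's repaired fact, through its reduction
  `example_2_8_coverticial'_of` to clause (2).

No definition; nothing here takes a side on [IUTchIII] Cor. 3.12.
-/

namespace Literature.AnabelianGeometry.SemiGraphs

open CategoryTheory CategoryTheory.PreGaloisCategory

universe v₁ u₁ u

namespace SemiGraphOfAnabelioids

variable {𝒢 : SemiGraphOfAnabelioids.{v₁, u₁, u}}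

/-- **[SemiAnbd] Example 2.8, coverticial half, second conjunct — verbatim AS TYPED** (p. 31; loops
`v = w` included): for `𝒢` with trivial edge anabelioids and a closed edge `e` joining `v` to `w`,
`e` is universally sub-coverticial iff `Π_v` and `Π_w` are infinite (at every basepoint).
[cite: MochizukiSemiAnbd2006, Ex. 2.8 p.31] -/
theorem isUniversallySubCoverticial_iff (hE : 𝒢.HasTrivialEdgeAnabelioids) {e : 𝒢.graph.Edge}
    {v w : 𝒢.graph.Vertex} (hj : 𝒢.graph.Joins e v w) :
    𝒢.IsUniversallySubCoverticial e ↔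
      (∀ (F : 𝒢.V v ⥤ FintypeCat.{v₁}) [FiberFunctor F], Infinite (Aut F)) ∧
        ∀ (F : 𝒢.V w ⥤ FintypeCat.{v₁}) [FiberFunctor F], Infinite (Aut F) :=
  ⟨infinite_and_infinite_of_isUniversallySubCoverticial hE hj,
    fun h => isUniversallySubCoverticial_of_infinite hE hj h.1 h.2⟩

/-- **The repaired [SemiAnbd] Example 2.8 (coverticial half) HOLDS**: abc-iut-L3-t1's named fact
`example_2_8_coverticial'` (F-1474 repaired: connected `𝒢` with trivial edge anabelioids; the
sub-coverticial criterion for `v ≠ w`, loops always sub-coverticial, the universally-sub-coverticial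
criterion as printed) is a theorem, via its reduction `example_2_8_coverticial'_of` to clause (2)
(`isUniversallySubCoverticial_iff`). [cite: MochizukiSemiAnbd2006, Ex. 2.8 p.31] -/
theorem example_2_8_coverticial'_holds :
    Literature.AnabelianGeometry.SemiGraphs.SemiGraphOfAnabelioids.example_2_8_coverticial'.{v₁, u₁, u} :=
  example_2_8_coverticial'_of fun _ _ hE _ _ _ hj => isUniversallySubCoverticial_iff hE hj

/-- **[SemiAnbd] Example 2.8, coverticial half — the printed statement for an edge joining two
DISTINCT vertices** (the repaired reading of the named fact `example_2_8_coverticial`, which omits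
`v ≠ w` and is refuted at loops by `not_example_2_8_coverticial`): if `𝒢_e` is trivial for all edges,
a closed edge joining `v ≠ w` is sub-coverticial iff `Π_v`, `Π_w` are nontrivial, and universally
sub-coverticial iff `Π_v`, `Π_w` are infinite. [cite: MochizukiSemiAnbd2006, Ex. 2.8 p.31] -/
theorem example_2_8_coverticial_of_ne (𝒢 : SemiGraphOfAnabelioids.{v₁, u₁, u})
    (hE : 𝒢.HasTrivialEdgeAnabelioids) (e : 𝒢.graph.Edge) (v w : 𝒢.graph.Vertex)
    (hj : 𝒢.graph.Joins e v w) (hvw : v ≠ w) :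
    (𝒢.IsSubCoverticial e ↔
      (∀ (F : 𝒢.V v ⥤ FintypeCat.{v₁}) [FiberFunctor F], Nontrivial (Aut F)) ∧
        ∀ (F : 𝒢.V w ⥤ FintypeCat.{v₁}) [FiberFunctor F], Nontrivial (Aut F)) ∧
    (𝒢.IsUniversallySubCoverticial e ↔
      (∀ (F : 𝒢.V v ⥤ FintypeCat.{v₁}) [FiberFunctor F], Infinite (Aut F)) ∧
        ∀ (F : 𝒢.V w ⥤ FintypeCat.{v₁}) [FiberFunctor F], Infinite (Aut F)) :=
  ⟨isSubCoverticial_iff_of_ne hE hj hvw, isUniversallySubCoverticial_iff hE hj⟩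

end SemiGraphOfAnabelioids

end Literature.AnabelianGeometry.SemiGraphs
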